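import Summits.AtomisticToContinuum.Crystallization.Theorems.ChartedZeroExcessLayeredLatticeLiouvilleZZZS

/-!
(SPLIT FOR THE 400-LINE CAP by the landing lane, hand-2 g41: this file = part 1 of 2; sequels `…ChartedZeroExcessLayeredLatticeLiouvilleZZZT` import it in a chain; same namespace, all FQNs unchanged.)
# ChartedZeroExcess · LayeredLatticeLiouville ZZZT (lens-2 g87 NODE 87) — «RigidQuotient»: THE KINEMATIC FLOOR (RDᴸ) CUT BY THE RIGID-MOTION
# QUOTIENT — (RDᴸ)(D₀ := cR·m₀) ⟸ (RGᴸ) «deficit ≥ cR × ℓ²-distance to the nearest PROPER RIGID COPY of the filling» [graph rigidity, the EXHAUSTION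
# lemma of the special/generic dichotomy] ∧ (TGᴸ) «off the outer tube, every rigid copy of every inner-tube configuration is m₀-far in ℓ²» [tube
# geometry]; and (O1) THE WELL MADE HONEST: (DWᴹ) `DeficitWellMinP` = (DWᴸ) about the MINIMISING critical filling, (XRᴸ) ∧ (X1ᴸ) ∧ (DWᴹ) ⟹ (DWᴸ)
# PROVED; W2‴ DOORS OF RECORD PROVED

Lineage `stmt-AtomisticToContinuum-26636` (route ChartedPlanarOrder, `ChartedZeroExcessLayered`), lens-2 «structural dichotomy (special vs generic)» g87.
BLOCKER FIRST: critic row 1562 (g86 «DeficitCurrency» VERIFIED; W2″ `[MCMC](ϑc) ⟸ (SC) ∧ (X1ᴸ) ∧ (X2ᴸ) ∧ (RDᴸ) ∧ (DWᴸ)` = energetic route of record;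
ORDERS (O1) make (DWᴸ) honest about finding F4 — a well about EVERY critical tame inner-tube filling silently contains uniqueness-modulo-rigid-motions
of such fillings — and (O2) type plan A per finding F1 — the deficit-ZERO locus is EXACTLY the rigid copies, so state the rigidity rung as `coreDeficit ≥
c_rig · inf_{R ∈ SO(3), c} Σ_i ‖xf i − (R·y i + c)‖²` and get (RDᴸ)(D₀) from the tube geometry, pricing the bond / interface / bulk exits (F3)).

THE LENS APPLIED INSIDE (RDᴸ).  SPECIAL class = the PROPER RIGID COPIES `i ↦ R (y i) + c` (`det R = 1`) of inner-tube configurations `y` — the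
structured, finite-dimensional (6-parameter) family on which the deficit vanishes identically (`coreDeficit_of_rigidCopy`, PROVED); GENERIC class =
cores at positive ℓ²-distance ★ `rigidMisfit y xf R c = Σ_i ‖xf i − (R (y i) + c)‖²` from that family.  EXHAUSTION LEMMA (quantitative, = piece (RGᴸ)):
every core is within `√(D/cR)` of the special class — the deficit against a filling DOMINATES `cR ×` the squared distance to the filling's proper rigid
orbit (finite-graph geometric rigidity on the `Rd = Rg` pair graph of the crystal patch: Friesecke–James–Müller 2002 Thm 3.1 in the discrete form of
Schmidt 2009 / Theil 2006; qualitatively = finding F1).  SPECIAL SIDE (= piece (TGᴸ)): the `m₀`-neighbourhood of the special class does not meet the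
off-tube region — pure tube geometry: the `ε`-registered collar pins `(R, c)` to the rigid budget `ω = sb₁ + Rg·φ*` of NODE 86 §4, and a violated
outer BOND clause then costs `≥ ½(sb − ω)²` at its two endpoints whatever `y` does inside the inner tube (INTERFACE exits are dead for admissible
cores — every interface-shell site is a registered atom by covering (CV₂♮), `ε ≪ dI`; BULK exits force a bond exit along the `≤ 4`-hop chain to the
registered zone, `ε + 4·sb < dB`).  Glue (PROVED, `offTubeDeficitFloorP_of_rigidity`): (RGᴸ)(cR ≥ 0) ∧ (TGᴸ)(m₀) ⟹ (RDᴸ)(cR·m₀).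

PIECES (statements over tree notions only; tags per the cell doctrine).
* ★★★ (RGᴸ) `DeficitRigidityP … Rg sb₁ dI₁ dB₁ Rd cR …` — GRAPH RIGIDITY: under the binders of (RDᴸ) WITHOUT the off-tube hypothesis, for every
  inner-tube `y` and every determinant-`1` rotation field `V` there is a PROPER rigid motion `(R, c)` with `cR · rigidMisfit y xf R c ≤ coreDeficit Rd
  (lab ∘ xf) y xf V`.  KINEMATIC · LJ-free · tube-exclusion-free (holds for in-tube and off-tube cores alike) · NEW · UNDECIDED · TRUE-type at `Rd = Rg
  = 121/25` (the patch pair graph is connected with full-rank stars) · WEAKER-in-kind than (RDᴸ) (no floor, no tube: must-fail probe MF-1) · TWO-SIDED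
  INSTRUMENTABLE «RigidityConstant-T» (per-site Kabsch deficit ÷ global-Kabsch misfit over the DeficitFloor-T matrix) · ATTACKABLE-M (finite-dimensional:
  `D` and `inf rigidMisfit` are both quadratic-type functionals vanishing exactly on the rigid orbit (F1); the constant is the second-order gap of `D`
  transverse to the orbit, uniform over the door class by compactness of the inner tube and finiteness of the patch types).  DESK VALUE (memo §4,
  `numerics/rigidity_constant.py`, exact Rayleigh–Ritz on the fcc patch with every truncated boundary star, validated nonlinearly by Horn fits to 0.1 %
  up to 10 % gradients): `c_rig ≈ 32.7` (core radius 16) … `21.5` (radius 20, the largest admissible core), softest mode = the even quadratic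
  bend/twist field `(y² − z², −xy, xz)`; the other end of the spectrum is the single displaced atom, quotient `2·682 = 1364`.  Vacuous at `cR ≤ 0`
  (`deficitRigidityP_of_nonpos`); FALSE-type for `Rd` below the bond length (empty pair graph).  Why it might fail: only a mis-set `cR`.
* ★★★ (TGᴸ) `OffTubeRigidGapP … Rg sb dI dB sb₁ dI₁ dB₁ m₀ …` — TUBE GEOMETRY: under the binders of (RDᴸ) (off the OUTER tube), for every inner-tube `y`
  and every PROPER rigid motion `(R, c)`: `m₀ ≤ rigidMisfit y xf R c`.  KINEMATIC · LJ-free · rotation-FIELD-free and deficit-free · NEW · UNDECIDED ·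
  TRUE-type in the THIN-inner-tube regime: DESK VALUE `m₀ = 5.5·10⁻⁴` at the fat door of record (memo §5, `numerics/rigid_gap.py`: the crossing, at
  rotation angle `α* = 1.10·φ*`, of the bond-exit price `A(α) = ½(sb − sb₁ − 2 sin(α/2)(Rg + sb₁))²` with the collar price `B(α) = Σ_shell (2 sin(α/2)·d_k
  − ε − dI₁)₊²` over the 16 690 `ε`-registered interface-shell sites; interface exits are dead and bulk exits force bond exits, `ε + 4·sb < dB`); FALSE at
  fat inner radii by NODE 86's rigid witness (misfit `0`) · WEAKER than (RDᴸ) — PROVED `offTubeRigidGapP_of_deficitFloor`: (RDᴸ)(D₀) ⟹ (TGᴸ)(D₀/(4N))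
  with the packing count `N`, via `coreDeficit_const_le` (the deficit in a CONSTANT field is `≤ 4n ×` the rigid misfit) · TWO-SIDED INSTRUMENTABLE
  «RigidGap-T» (global Kabsch of the off-tube samples against adversarial inner-tube `y`) · ATTACKABLE-S (elementary: collar pinning of `(R, c)` in ℓ²,
  then the bond-exit price; first rungs PROVED here: `rigidMisfit_refl_interfaceClause`, `rigidMisfit_refl_bondClause`).  Why it might fail: only the
  thin-regime bookkeeping `ω < sb`.  NET FLOOR `D₀ := cR·m₀ ≈ 1.2·10⁻²` — about `1/130` of NODE 86's single-atom estimate `1.54`, because the rigidity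
  cut prices EVERY exit at the softest mode's rate; harmless, only `0 < cE·D₀ − σ₀` enters the door.
* ★★ (DWᴹ) `DeficitWellMinP … Rg sb₁ dI₁ dB₁ Rd cE σ₀ …` — (DWᴸ) with ONE MORE HYPOTHESIS on the filling `y`: it MINIMISES the clamped energy over the
  inner tube.  ENERGETIC · rotation-covariant · WEAKER than (DWᴸ) (trivially, `DeficitWellP.toMin`) · EQUIVALENT to (DWᴸ) GIVEN (XRᴸ) ∧ (X1ᴸ) (PROVED
  `deficitWellP_of_min`: first-order convexity on the outer tube makes every critical inner-tube filling THE minimiser) · TRUE-type at `σ₀ = 0`, `cE ≲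
  5·10⁻⁴` on its own (no hidden uniqueness: two distinct minimisers have equal energy, so the well only asks them to be rigid copies OF EACH OTHER when
  `σ₀ = 0`, which (X1ᴸ) grants and which is the honest content) · TWO-SIDED INSTRUMENTABLE «WellModulus-T» ABOUT THE MINIMISER (critic (O3)) · ATTACKABLE-L
  (clamped lattice Hessian stability modulo sitewise rotations at the minimiser: E–Ming 2007, Ortner–Theil 2013, Hudson–Ortner 2014).
  NOTE on F4's literal form: «apply (DWᴸ) with `(xf, y) := (y′, y)`» does not type — `xf` must ENUMERATE `coreOf S K ρ` of the same `S` that carries the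
  door binders; the swap needs the re-instantiation `S′ := (S ∖ core) ∪ range y′` with all binders re-verified.  (DWᴹ) removes the issue at the root.

NET (0 sorry): `offTubeDeficitFloorP_of_rigidity` (RGᴸ) ∧ (TGᴸ) ⟹ (RDᴸ)(cR·m₀); `deficitWellP_of_min` (XRᴸ) ∧ (X1ᴸ)(0 ≤ lam) ∧ (DWᴹ) ⟹ (DWᴸ);
`offTubeGapP_of_rigidity` (RGᴸ) ∧ (TGᴸ) ∧ (DWᴸ) ⟹ (OGᴸ)(cE·cR·m₀ − σ₀); doors `mildCoolMoatCorePG_W2'''_record` / `_fat`: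
**`[MCMC](ϑc)` ⟸ (SC) ∧ (X1ᴸ) ∧ (X2ᴸ) ∧ (RGᴸ)(cR) ∧ (TGᴸ)(m₀) ∧ (DWᴹ)(cE, σ₀)** (`0 ≤ cR`, `0 ≤ cE`, `σ₀ < cE·cR·m₀`); weaker-than certificates
`offTubeRigidGapP_of_deficitFloor`, `DeficitWellP.toMin`; special-class lemmas `rigidMisfit_eq_zero_iff`, `coreDeficit_of_rigidCopy`; first rungs of
(TGᴸ); vacuity guards; monotonicity in every dial.  WHY NOVEL (vs NODE 86 and everything before it on this line): the cut is by the QUOTIENT BY PROPER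
RIGID MOTIONS — the deficit floor factors through the ℓ²-distance to a 6-parameter orbit, separating a pure finite-graph rigidity inequality (no tube, no
energy, no crystal beyond the pair graph) from a pure tube-geometry statement (no rotation field, no deficit); the rigid-motion degeneracy that NODE 86
had to fence by hand is now the special class itself.  WHY EACH PIECE IS STRICTLY WEAKER than (RDᴸ): (TGᴸ) is implied by (RDᴸ) (PROVED) and says nothing
about rotation fields; (RGᴸ) has no tube exclusion and gives no floor by itself (rigid copies have deficit `0`); (DWᴹ) is implied by (DWᴸ).
Sources: tree ZZZS (NODE 86); G. Friesecke, R. D. James, S. Müller, CPAM 55 (2002) 1461, Thm 3.1; B. Schmidt, Multiscale Model. Simul. 8 (2009) 520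
(discrete rigidity); F. Theil, CMP 262 (2006) 209; W. E, P. Ming, ARMA 183 (2007) 241; C. Ortner, F. Theil, ARMA 207 (2013) 1025; T. Hudson, C. Ortner,
ARMA 213 (2014) 887; W. Kabsch, Acta Cryst. A32 (1976) 922 (optimal rigid superposition = the instruments' misfit); memo NODE-g87.

0 sorry; imports = tree ZZZS only; axioms standard.
-/

noncomputable section

open scoped BigOperators Classical InnerProductSpace RealInnerProductSpace
open MeasureTheory Set Metric Filter Topology
open Literature.Geometry.DiscreteGeometry (IsTwoShellGoodSet)
open Literature.MathematicalPhysics.StatisticalMechanics (lennardJones card_le_of_separated_of_dist_le)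

namespace Summit.AtomisticToContinuum.Crystallization.Theorems.ChartedZeroExcessLayeredLatticeLiouville

open Summit.AtomisticToContinuum.Crystallization.Theorems.ChartedPlanarOrderRigidityDoor (E3 IsClean)
open Summit.AtomisticToContinuum.Crystallization.Theorems.ChartedPlanarOrderDensityDichotomy (μS IsSep)
open Summit.AtomisticToContinuum.Crystallization.Theorems.ChartedPlanarOrderCleanScaleP (IsCleanP IsDoorSetP)
open Summit.AtomisticToContinuum.Crystallization.Theorems.ChartedPlanarOrderMesoCut (LayeredHom EnvClose)
open Summit.AtomisticToContinuum.Crystallization.Theorems.ChartedPlanarOrderDoorLayeredOsc (IsTwoShellAffineGood)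

/-! ### ZZZT-1  The special class: proper rigid copies; the ℓ² rigid misfit; the deficit vanishes on rigid copies -/

section RigidMisfit

variable {n : ℕ}

/-- ★ **`rigidMisfit y xf R c`** — THE ℓ²-DISTANCE OF THE CORE `xf` TO THE RIGID COPY `i ↦ R (y i) + c` OF THE FILLING `y`:
`Σ_i ‖xf i − (R (y i) + c)‖²`.  Its infimum over PROPER rigid motions `(R, c)` is the squared distance of `xf` to the SPECIAL class of the dichotomy
(the 6-parameter orbit of `y`); the instruments compute it by Kabsch superposition. [this file, g87] -/
def rigidMisfit (y xf : Fin n → E3) (R : E3 ≃ₗᵢ[ℝ] E3) (c : E3) : ℝ := ∑ i, ‖xf i - (R (y i) + c)‖ ^ 2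

variable {Rd : ℝ} {y₀ y xf : Fin n → E3} {R : E3 ≃ₗᵢ[ℝ] E3} {c : E3}

/-- the misfit is nonnegative. [formal bookkeeping] -/
theorem rigidMisfit_nonneg : 0 ≤ rigidMisfit y xf R c := Finset.sum_nonneg fun i _ => by positivity

/-- a single site is below the misfit. [formal bookkeeping] -/
theorem term_le_rigidMisfit (i : Fin n) : ‖xf i - (R (y i) + c)‖ ^ 2 ≤ rigidMisfit y xf R c :=
  Finset.single_le_sum (f := fun i' => ‖xf i' - (R (y i') + c)‖ ^ 2) (fun i' _ => by positivity) (Finset.mem_univ i)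

/-- ★ THE SPECIAL CLASS: the misfit vanishes EXACTLY on the rigid copy `xf = R ∘ y + c`. [this file, g87] -/
theorem rigidMisfit_eq_zero_iff : rigidMisfit y xf R c = 0 ↔ ∀ i, xf i = R (y i) + c := by
  unfold rigidMisfit
  rw [Finset.sum_eq_zero_iff_of_nonneg fun i _ => by positivity]
  simp only [Finset.mem_univ, forall_const, ne_eq, OfNat.ofNat_ne_zero, not_false_eq_true, pow_eq_zero_iff, norm_eq_zero, sub_eq_zero]

/-- ★ **THE DEFICIT VANISHES ON THE SPECIAL CLASS (PROVED)**: a rigid copy `xf = R ∘ y + c` has deficit `0` in the constant field `R`, at every pair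
range and for every reference. [this file, g87] -/
theorem coreDeficit_of_rigidCopy (h : ∀ i, xf i = R (y i) + c) : coreDeficit Rd y₀ y xf (fun _ => R) = 0 := by
  unfold coreDeficit
  refine Finset.sum_eq_zero fun i _ => Finset.sum_eq_zero fun j _ => ?_
  have hz : (xf j - xf i) - R (y j - y i) = 0 := by rw [h i, h j, map_sub]; abel
  rw [hz, norm_zero]
  simp

/-- ★ **THE DEFICIT IN A CONSTANT FIELD IS DOMINATED BY THE RIGID MISFIT (PROVED)**: `D_Rd(xf; y, R) ≤ 4·n·rigidMisfit y xf R c` for every `c`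
(each pair term is `≤ 2‖e_i‖² + 2‖e_j‖²` with `e_i = xf i − (R (y i) + c)`, then count).  The kinematic converse of (RGᴸ) and the engine of the
weaker-than certificate (RDᴸ) ⟹ (TGᴸ). [this file, g87] -/
theorem coreDeficit_const_le : coreDeficit Rd y₀ y xf (fun _ => R) ≤ 4 * n * rigidMisfit y xf R c := by
  have hterm : ∀ i j, (if dist (y₀ i) (y₀ j) ≤ Rd then ‖(xf j - xf i) - R (y j - y i)‖ ^ 2 else 0) ≤
      2 * ‖xf i - (R (y i) + c)‖ ^ 2 + 2 * ‖xf j - (R (y j) + c)‖ ^ 2 := by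
    intro i j
    have h0 : 0 ≤ 2 * ‖xf i - (R (y i) + c)‖ ^ 2 + 2 * ‖xf j - (R (y j) + c)‖ ^ 2 := by positivity
    split_ifs
    · have hre : (xf j - xf i) - R (y j - y i) = (xf j - (R (y j) + c)) - (xf i - (R (y i) + c)) := by rw [map_sub]; abel
      rw [hre]
      have h1 : ‖(xf j - (R (y j) + c)) - (xf i - (R (y i) + c))‖ ≤ ‖xf j - (R (y j) + c)‖ + ‖xf i - (R (y i) + c)‖ := norm_sub_le _ _
      have h2 : 0 ≤ ‖(xf j - (R (y j) + c)) - (xf i - (R (y i) + c))‖ := norm_nonneg _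
      nlinarith [sq_nonneg (‖xf j - (R (y j) + c)‖ - ‖xf i - (R (y i) + c)‖), norm_nonneg (xf j - (R (y j) + c)),
        norm_nonneg (xf i - (R (y i) + c))]
    · exact h0
  calc coreDeficit Rd y₀ y xf (fun _ => R)
      ≤ ∑ i, ∑ j, (2 * ‖xf i - (R (y i) + c)‖ ^ 2 + 2 * ‖xf j - (R (y j) + c)‖ ^ 2) :=
        Finset.sum_le_sum fun i _ => Finset.sum_le_sum fun j _ => hterm i j
    _ = ∑ i, ((n : ℝ) * (2 * ‖xf i - (R (y i) + c)‖ ^ 2) + 2 * ∑ j, ‖xf j - (R (y j) + c)‖ ^ 2) := by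
        refine Finset.sum_congr rfl fun i _ => ?_
        rw [Finset.sum_add_distrib, Finset.sum_const, Finset.card_univ, Fintype.card_fin, nsmul_eq_mul, Finset.mul_sum]
    _ = 4 * n * rigidMisfit y xf R c := by
        unfold rigidMisfit
        rw [Finset.sum_add_distrib, Finset.sum_const, Finset.card_univ, Fintype.card_fin, nsmul_eq_mul, ← Finset.mul_sum, ← Finset.mul_sum]
        ring

/-- two squares dominate half the square of the difference (the parallelogram bound used by the bond-exit rung). [formal bookkeeping] -/
theorem half_sq_norm_sub_le (u v : E3) : ‖u - v‖ ^ 2 / 2 ≤ ‖u‖ ^ 2 + ‖v‖ ^ 2 := by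
  have h1 : ‖u - v‖ ≤ ‖u‖ + ‖v‖ := norm_sub_le u v
  have h2 : 0 ≤ ‖u - v‖ := norm_nonneg _
  nlinarith [sq_nonneg (‖u‖ - ‖v‖), norm_nonneg u, norm_nonneg v]

/-- ★ **FIRST RUNG OF (TGᴸ), INTERFACE CLAUSE (PROVED)**: with the IDENTITY motion, an interface-clause exit at one site floors the misfit:
`dist (xf i) (y₀ i) > dI` and `dist (y i) (y₀ i) ≤ dI₁ ≤ dI` give `(dI − dI₁)² ≤ rigidMisfit y xf 1 0`.  (For ADMISSIBLE cores this exit is dead — every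
interface-shell site is `ε`-registered — so the rung only documents the currency.) [this file, g87] -/
theorem rigidMisfit_refl_interfaceClause {dI dI₁ : ℝ} (hdI : dI₁ ≤ dI) (i : Fin n) (hoff : dI < dist (xf i) (y₀ i))
    (hin : dist (y i) (y₀ i) ≤ dI₁) : (dI - dI₁) ^ 2 ≤ rigidMisfit y xf (LinearIsometryEquiv.refl ℝ E3) 0 := by
  have key := term_le_rigidMisfit (xf := xf) (y := y) (R := LinearIsometryEquiv.refl ℝ E3) (c := 0) i
  simp only [LinearIsometryEquiv.coe_refl, id_eq, add_zero] at key
  have htri : dist (xf i) (y₀ i) ≤ ‖xf i - y i‖ + dist (y i) (y₀ i) := by rw [← dist_eq_norm]; exact dist_triangle _ _ _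
  have hlow : dI - dI₁ ≤ ‖xf i - y i‖ := by linarith
  have h0 : 0 ≤ dI - dI₁ := by linarith
  exact (pow_le_pow_left₀ h0 hlow 2).trans key

/-- ★ **FIRST RUNG OF (TGᴸ), BOND CLAUSE (PROVED)**: with the IDENTITY motion, a violated outer bond clause floors the misfit at its two endpoints:
`dist (xf i − xf j) (y₀ i − y₀ j) > sb` and `dist (y i − y j) (y₀ i − y₀ j) ≤ sb₁ ≤ sb` give `(sb − sb₁)²/2 ≤ rigidMisfit y xf 1 0`.  The content of (TGᴸ)
beyond the rung is the collar pinning of a GENERAL proper `(R, c)` to the rigid budget `ω` (then `sb − sb₁` becomes `sb − ω`). [this file, g87] -/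
theorem rigidMisfit_refl_bondClause {sb sb₁ : ℝ} (hsb : sb₁ ≤ sb) (i j : Fin n) (hoff : sb < dist (xf i - xf j) (y₀ i - y₀ j))
    (hin : dist (y i - y j) (y₀ i - y₀ j) ≤ sb₁) : (sb - sb₁) ^ 2 / 2 ≤ rigidMisfit y xf (LinearIsometryEquiv.refl ℝ E3) 0 := by
  have ki := term_le_rigidMisfit (xf := xf) (y := y) (R := LinearIsometryEquiv.refl ℝ E3) (c := 0) i
  have kj := term_le_rigidMisfit (xf := xf) (y := y) (R := LinearIsometryEquiv.refl ℝ E3) (c := 0) j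
  simp only [LinearIsometryEquiv.coe_refl, id_eq, add_zero] at ki kj
  have htri : dist (xf i - xf j) (y₀ i - y₀ j) ≤ ‖(xf i - xf j) - (y i - y j)‖ + dist (y i - y j) (y₀ i - y₀ j) := by
    rw [← dist_eq_norm]; exact dist_triangle _ _ _
  have hlow : sb - sb₁ ≤ ‖(xf i - xf j) - (y i - y j)‖ := by linarith
  have h0 : 0 ≤ sb - sb₁ := by linarith
  have hsq : (sb - sb₁) ^ 2 ≤ ‖(xf i - xf j) - (y i - y j)‖ ^ 2 := pow_le_pow_left₀ h0 hlow 2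
  have hre : (xf i - xf j) - (y i - y j) = (xf i - y i) - (xf j - y j) := by abel
  rw [hre] at hsq
  have hpar := half_sq_norm_sub_le (xf i - y i) (xf j - y j)
  -- the two endpoint terms are distinct summands of the misfit unless `i = j` (then the bond clause cannot be violated: both deviations are `0`)
  by_cases hij : i = j
  · subst hij
    simp only [sub_self, dist_self] at hoff
    linarith [hin.trans hsb, dist_nonneg (x := y i - y i) (y := y₀ i - y₀ i)]
  · have two : ‖xf i - y i‖ ^ 2 + ‖xf j - y j‖ ^ 2 ≤ rigidMisfit y xf (LinearIsometryEquiv.refl ℝ E3) 0 := by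
      unfold rigidMisfit
      simp only [LinearIsometryEquiv.coe_refl, id_eq, add_zero]
      have hpair : ∑ k ∈ ({i, j} : Finset (Fin n)), ‖xf k - y k‖ ^ 2 = ‖xf i - y i‖ ^ 2 + ‖xf j - y j‖ ^ 2 := Finset.sum_pair hij
      rw [← hpair]
      exact Finset.sum_le_sum_of_subset_of_nonneg (Finset.subset_univ _) fun k _ _ => by positivity
    linarith

end RigidMisfit

/-! ### ZZZT-2  The pieces: (RGᴸ) graph rigidity, (TGᴸ) the off-tube rigid gap, (DWᴹ) the well about the minimiser -/

section Pieces

/-- ★★★ **(RGᴸ) «DeficitRigidityP … Rg sb₁ dI₁ dB₁ Rd cR …» — GRAPH RIGIDITY: THE DEFICIT DOMINATES `cR ×` THE ℓ²-DISTANCE TO THE PROPER RIGID ORBIT OF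
THE FILLING.**  Under the binders of (RDᴸ) WITHOUT the off-tube hypothesis (θ-good `aHi`-door set, LJ summable, equilibrium chart, container,
`ϑp`-mild `rm`-core, `ϑc`-cool moat, enumerated `ρ`-core `xf`, cool shadow crystal, bond label `lab`): for every `y` in the inner tube `bondTube (S ∖
core) Rg sb₁ dI₁ dB₁ (lab ∘ xf)` and every field `V` of determinant-`1` linear isometries there are a linear isometry `R` with `det R = 1` and a vector
`c` with `cR · rigidMisfit y xf R c ≤ coreDeficit Rd (lab ∘ xf) y xf V`.  KINEMATIC · LJ-free · NO tube exclusion · NEW · UNDECIDED · TRUE-type at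
`Rd = Rg = 121/25` (connected patch pair graph with full-rank stars; desk `c_rig ≈ 21.5 … 32.7`, memo §4) · WEAKER-in-kind than (RDᴸ) · TWO-SIDED
INSTRUMENTABLE «RigidityConstant-T» · ATTACKABLE-M (finite-graph FJM rigidity: Schmidt 2009, Theil 2006; FJM 2002 Thm 3.1).  Vacuous for `cR ≤ 0`
(`deficitRigidityP_of_nonpos`); FALSE-type for `Rd` below the bond length.  Why it might fail: only a mis-set `cR`.  Sources: module docstring.
[this file, g87] -/
def DeficitRigidityP (ϑc ϑp r rΘ q rsh ρ rm σ ϑr Rs ε rI ℓ Rg sb₁ dI₁ dB₁ Rd cR aHi Λ θ s : ℝ) : Prop :=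
  ∀ δ : ℝ, 0 < δ → ∀ a : ℝ, 0 < a →
    ∀ S : Set E3, IsDoorSetP aHi δ S → (∀ z : E3, Summable fun y : S => lennardJones (dist z (y : E3))) →
      (∀ p ∈ S, IsTwoShellAffineGood θ S p) →
        ∀ (L : E3 ≃L[ℝ] E3) (w : ℤ → E3), IsEquilChart a s Λ L w →
          ∀ (x₀ : E3) (K : Set E3), K ⊆ S → (∀ k ∈ K, dist k x₀ ≤ q) →
            IsTameOn ϑp S (LayeredHom (L : E3 →L[ℝ] E3) w) (coreOf S K rm) →
              IsTameOn ϑc S (LayeredHom (L : E3 →L[ℝ] E3) w) (moatIn S K r (r + rsh)) →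
                ∀ (n : ℕ) (xf : Fin n → E3), Function.Injective xf → Set.range xf = coreOf S K ρ →
                  ∀ (L' : E3 →L[ℝ] E3) (w' : ℤ → E3) (U : E3 ≃ₗᵢ[ℝ] E3) (t : E3),
                    IsCoolShadowCrystal σ ϑr Rs ε r rI ℓ S K (LayeredHom (L : E3 →L[ℝ] E3) w) L' w' U t →
                      ∀ lab : E3 → E3, IsBondLabel ε rΘ ℓ S K (placedCrystal L' w' U t) lab →
                        ∀ y ∈ bondTube (S \ coreOf S K ρ) Rg sb₁ dI₁ dB₁ (fun i => lab (xf i)),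
                          ∀ V : Fin n → (E3 ≃ₗᵢ[ℝ] E3), (∀ i, LinearMap.det ((V i).toLinearEquiv : E3 →ₗ[ℝ] E3) = 1) →
                            ∃ (R : E3 ≃ₗᵢ[ℝ] E3) (c : E3), LinearMap.det (R.toLinearEquiv : E3 →ₗ[ℝ] E3) = 1 ∧
                              cR * rigidMisfit y xf R c ≤ coreDeficit Rd (fun i => lab (xf i)) y xf V

/-- ★★★ **(TGᴸ) «OffTubeRigidGapP … Rg sb dI dB sb₁ dI₁ dB₁ m₀ …» — TUBE GEOMETRY: OFF THE OUTER TUBE, EVERY PROPER RIGID COPY OF EVERY INNER-TUBE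
CONFIGURATION IS `m₀`-FAR IN ℓ².**  Under the binders of (RDᴸ) (including `xf ∉ bondTube (S ∖ core) Rg sb dI dB (lab ∘ xf)`): for every `y` in the inner
tube, every linear isometry `R` with `det R = 1` and every `c`: `m₀ ≤ rigidMisfit y xf R c`.  KINEMATIC · LJ-free · rotation-FIELD-free · deficit-free ·
NEW · UNDECIDED · TRUE-type in the THIN-inner-tube regime, desk `m₀ = 5.5·10⁻⁴` at the fat door of record (bond-exit price `½(sb − ω(α))²` against the
collar price, crossing at `α* ≈ 1.1·dI₁/ρₐ`; FALSE at fat inner radii by NODE 86's rigid witness, misfit `0`) · WEAKER than (RDᴸ) (PROVED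
`offTubeRigidGapP_of_deficitFloor`) ·
TWO-SIDED INSTRUMENTABLE «RigidGap-T» · ATTACKABLE-S (collar pinning + bond-exit price; rungs `rigidMisfit_refl_bondClause`, `…_interfaceClause`).
Monotone in the outer radii, antitone in the inner radii and in `m₀`; vacuous for `m₀ ≤ 0` (`offTubeRigidGapP_of_nonpos`).  Why it might fail: only the
thin-regime bookkeeping.  Sources: module docstring; NODE 86 §4 (`rigid_budget.py`). [this file, g87] -/
def OffTubeRigidGapP (ϑc ϑp r rΘ q rsh ρ rm σ ϑr Rs ε rI ℓ Rg sb dI dB sb₁ dI₁ dB₁ m₀ aHi Λ θ s : ℝ) : Prop :=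
  ∀ δ : ℝ, 0 < δ → ∀ a : ℝ, 0 < a →
    ∀ S : Set E3, IsDoorSetP aHi δ S → (∀ z : E3, Summable fun y : S => lennardJones (dist z (y : E3))) →
      (∀ p ∈ S, IsTwoShellAffineGood θ S p) →
        ∀ (L : E3 ≃L[ℝ] E3) (w : ℤ → E3), IsEquilChart a s Λ L w →
          ∀ (x₀ : E3) (K : Set E3), K ⊆ S → (∀ k ∈ K, dist k x₀ ≤ q) →
            IsTameOn ϑp S (LayeredHom (L : E3 →L[ℝ] E3) w) (coreOf S K rm) →
              IsTameOn ϑc S (LayeredHom (L : E3 →L[ℝ] E3) w) (moatIn S K r (r + rsh)) →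
                ∀ (n : ℕ) (xf : Fin n → E3), Function.Injective xf → Set.range xf = coreOf S K ρ →
                  ∀ (L' : E3 →L[ℝ] E3) (w' : ℤ → E3) (U : E3 ≃ₗᵢ[ℝ] E3) (t : E3),
                    IsCoolShadowCrystal σ ϑr Rs ε r rI ℓ S K (LayeredHom (L : E3 →L[ℝ] E3) w) L' w' U t →
                      ∀ lab : E3 → E3, IsBondLabel ε rΘ ℓ S K (placedCrystal L' w' U t) lab →
                        xf ∉ bondTube (S \ coreOf S K ρ) Rg sb dI dB (fun i => lab (xf i)) →
                          ∀ y ∈ bondTube (S \ coreOf S K ρ) Rg sb₁ dI₁ dB₁ (fun i => lab (xf i)),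
                            ∀ (R : E3 ≃ₗᵢ[ℝ] E3) (c : E3), LinearMap.det (R.toLinearEquiv : E3 →ₗ[ℝ] E3) = 1 →
                              m₀ ≤ rigidMisfit y xf R c

/-- ★★ **(DWᴹ) «DeficitWellMinP … Rg sb₁ dI₁ dB₁ Rd cE σ₀ …» — THE CLAMPED ENERGY IS A `cE`-WELL IN THE DEFICIT ABOUT THE MINIMISING CRITICAL TAME
INNER-TUBE FILLING, UP TO `σ₀`.**  Tree ZZZS's (DWᴸ) `DeficitWellP` with ONE MORE hypothesis on `y`: it MINIMISES `clampedEnergy (S ∖ core)` over the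
inner tube `bondTube (S ∖ core) Rg sb₁ dI₁ dB₁ (lab ∘ xf)`.  ENERGETIC · rotation-covariant · WEAKER than (DWᴸ) (`DeficitWellP.toMin`) · EQUIVALENT to
(DWᴸ) given (XRᴸ) ∧ (X1ᴸ) (`deficitWellP_of_min`) · TRUE-type at `σ₀ = 0`, `cE ≲ 5·10⁻⁴` · TWO-SIDED INSTRUMENTABLE «WellModulus-T» about the minimiser
· ATTACKABLE-L (Hessian stability modulo sitewise rotations AT THE MINIMISER).  Why it might fail: two non-congruent minimisers in the inner tube
(`σ₀` must then be positive), or anharmonic softening toward bond strain `ϑp`.  Sources: tree ZZZS; critic row 1562 (F4), (O1). [this file, g87] -/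
def DeficitWellMinP (ϑc ϑ ϑp r rΘ q rsh ρ rm σ ϑr Rs ε rI ℓ Rg sb₁ dI₁ dB₁ Rd cE σ₀ aHi Λ θ s : ℝ) : Prop :=
  ∀ δ : ℝ, 0 < δ → ∀ a : ℝ, 0 < a →
    ∀ S : Set E3, IsDoorSetP aHi δ S → (∀ z : E3, Summable fun y : S => lennardJones (dist z (y : E3))) →
      (∀ p ∈ S, IsTwoShellAffineGood θ S p) →
        ∀ (L : E3 ≃L[ℝ] E3) (w : ℤ → E3), IsEquilChart a s Λ L w →
          ∀ (x₀ : E3) (K : Set E3), K ⊆ S → (∀ k ∈ K, dist k x₀ ≤ q) →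
            IsTameOn ϑp S (LayeredHom (L : E3 →L[ℝ] E3) w) (coreOf S K rm) →
              IsTameOn ϑc S (LayeredHom (L : E3 →L[ℝ] E3) w) (moatIn S K r (r + rsh)) →
                ∀ (n : ℕ) (xf : Fin n → E3), Function.Injective xf → Set.range xf = coreOf S K ρ →
                  ∀ (L' : E3 →L[ℝ] E3) (w' : ℤ → E3) (U : E3 ≃ₗᵢ[ℝ] E3) (t : E3),
                    IsCoolShadowCrystal σ ϑr Rs ε r rI ℓ S K (LayeredHom (L : E3 →L[ℝ] E3) w) L' w' U t →
                      ∀ lab : E3 → E3, IsBondLabel ε rΘ ℓ S K (placedCrystal L' w' U t) lab →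
                        ∀ y ∈ bondTube (S \ coreOf S K ρ) Rg sb₁ dI₁ dB₁ (fun i => lab (xf i)),
                          Function.Injective y → Disjoint (Set.range y) (S \ coreOf S K ρ) →
                            HasFDerivAt (fun z : Fin n → E3 => clampedEnergy (S \ coreOf S K ρ) z) (0 : (Fin n → E3) →L[ℝ] ℝ) y →
                              (∀ i, IsTameStar ϑ ((S \ coreOf S K ρ) ∪ Set.range y) (LayeredHom (L : E3 →L[ℝ] E3) w) (y i)) →
                                (∀ z ∈ bondTube (S \ coreOf S K ρ) Rg sb₁ dI₁ dB₁ (fun i => lab (xf i)),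
                                    clampedEnergy (S \ coreOf S K ρ) y ≤ clampedEnergy (S \ coreOf S K ρ) z) →
                                  ∃ V : Fin n → (E3 ≃ₗᵢ[ℝ] E3), (∀ i, LinearMap.det ((V i).toLinearEquiv : E3 →ₗ[ℝ] E3) = 1) ∧
                                    clampedEnergy (S \ coreOf S K ρ) y + cE * coreDeficit Rd (fun i => lab (xf i)) y xf V - σ₀ ≤
                                      clampedEnergy (S \ coreOf S K ρ) xf

/-- VACUITY GUARD: (RGᴸ) with `cR ≤ 0` is free (take the identity motion; the deficit is nonnegative). [formal bookkeeping] -/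
theorem deficitRigidityP_of_nonpos {ϑc ϑp r rΘ q rsh ρ rm σ ϑr Rs ε rI ℓ Rg sb₁ dI₁ dB₁ Rd cR aHi Λ θ s : ℝ} (hcR : cR ≤ 0) :
    DeficitRigidityP ϑc ϑp r rΘ q rsh ρ rm σ ϑr Rs ε rI ℓ Rg sb₁ dI₁ dB₁ Rd cR aHi Λ θ s :=
  fun _ _ _ _ _ _ _ _ _ _ _ _ _ _ _ _ _ _ _ _ _ _ _ _ _ _ _ _ _ _ _ _ =>
    ⟨LinearIsometryEquiv.refl ℝ E3, 0, det_refl_E3_eq_one,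
      (mul_nonpos_of_nonpos_of_nonneg hcR rigidMisfit_nonneg).trans coreDeficit_nonneg⟩

/-- (RGᴸ) is antitone in the constant and monotone in the pair range. [formal bookkeeping] -/
theorem DeficitRigidityP.of_le {ϑc ϑp r rΘ q rsh ρ rm σ ϑr Rs ε rI ℓ Rg sb₁ dI₁ dB₁ Rd Rd' cR cR' aHi Λ θ s : ℝ} (hc : cR' ≤ cR) (hRd : Rd ≤ Rd')
    (h : DeficitRigidityP ϑc ϑp r rΘ q rsh ρ rm σ ϑr Rs ε rI ℓ Rg sb₁ dI₁ dB₁ Rd cR aHi Λ θ s) :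
    DeficitRigidityP ϑc ϑp r rΘ q rsh ρ rm σ ϑr Rs ε rI ℓ Rg sb₁ dI₁ dB₁ Rd' cR' aHi Λ θ s := by
  intro δ hδ a ha S hS hsum hgood L w hLw x₀ K hKS hKq hmild hcool n xf hxf hrange L' w' U t hC lab hlab y hyT V hV
  obtain ⟨R, c, hR, hle⟩ := h δ hδ a ha S hS hsum hgood L w hLw x₀ K hKS hKq hmild hcool n xf hxf hrange L' w' U t hC lab hlab y hyT V hV
  refine ⟨R, c, hR, ?_⟩
  have h1 := coreDeficit_mono (y₀ := fun i => lab (xf i)) (y := y) (xf := xf) (U := V) hRd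
  nlinarith [mul_le_mul_of_nonneg_right hc (rigidMisfit_nonneg (y := y) (xf := xf) (R := R) (c := c))]

/-- (RGᴸ) is antitone in the inner radii (fewer fillings). [formal bookkeeping] -/
theorem DeficitRigidityP.mono_radii {ϑc ϑp r rΘ q rsh ρ rm σ ϑr Rs ε rI ℓ Rg sb₁ dI₁ dB₁ sb₁' dI₁' dB₁' Rd cR aHi Λ θ s : ℝ}
    (hsb₁ : sb₁' ≤ sb₁) (hdI₁ : dI₁' ≤ dI₁) (hdB₁ : dB₁' ≤ dB₁)
    (h : DeficitRigidityP ϑc ϑp r rΘ q rsh ρ rm σ ϑr Rs ε rI ℓ Rg sb₁ dI₁ dB₁ Rd cR aHi Λ θ s) :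
    DeficitRigidityP ϑc ϑp r rΘ q rsh ρ rm σ ϑr Rs ε rI ℓ Rg sb₁' dI₁' dB₁' Rd cR aHi Λ θ s :=
  fun δ hδ a ha S hS hsum hgood L w hLw x₀ K hKS hKq hmild hcool n xf hxf hrange L' w' U t hC lab hlab y hyT V hV =>
    h δ hδ a ha S hS hsum hgood L w hLw x₀ K hKS hKq hmild hcool n xf hxf hrange L' w' U t hC lab hlab y (bondTube_mono hsb₁ hdI₁ hdB₁ hyT) V hV

/-- VACUITY GUARD: (TGᴸ) with a nonpositive gap is free — the content is `m₀ > 0`. [formal bookkeeping] -/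
theorem offTubeRigidGapP_of_nonpos {ϑc ϑp r rΘ q rsh ρ rm σ ϑr Rs ε rI ℓ Rg sb dI dB sb₁ dI₁ dB₁ m₀ aHi Λ θ s : ℝ} (hm : m₀ ≤ 0) :
    OffTubeRigidGapP ϑc ϑp r rΘ q rsh ρ rm σ ϑr Rs ε rI ℓ Rg sb dI dB sb₁ dI₁ dB₁ m₀ aHi Λ θ s :=
  fun _ _ _ _ _ _ _ _ _ _ _ _ _ _ _ _ _ _ _ _ _ _ _ _ _ _ _ _ _ _ _ _ _ _ => hm.trans rigidMisfit_nonneg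

/-- (TGᴸ) is antitone in the gap, monotone in the OUTER radii and antitone in the INNER radii. [formal bookkeeping] -/
theorem OffTubeRigidGapP.mono {ϑc ϑp r rΘ q rsh ρ rm σ ϑr Rs ε rI ℓ Rg sb dI dB sb' dI' dB' sb₁ dI₁ dB₁ sb₁' dI₁' dB₁' m₀ m₀' aHi Λ θ s : ℝ}
    (hm : m₀' ≤ m₀) (hsb : sb ≤ sb') (hdI : dI ≤ dI') (hdB : dB ≤ dB') (hsb₁ : sb₁' ≤ sb₁) (hdI₁ : dI₁' ≤ dI₁) (hdB₁ : dB₁' ≤ dB₁)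
    (h : OffTubeRigidGapP ϑc ϑp r rΘ q rsh ρ rm σ ϑr Rs ε rI ℓ Rg sb dI dB sb₁ dI₁ dB₁ m₀ aHi Λ θ s) :
    OffTubeRigidGapP ϑc ϑp r rΘ q rsh ρ rm σ ϑr Rs ε rI ℓ Rg sb' dI' dB' sb₁' dI₁' dB₁' m₀' aHi Λ θ s :=
  fun δ hδ a ha S hS hsum hgood L w hLw x₀ K hKS hKq hmild hcool n xf hxf hrange L' w' U t hC lab hlab hoff y hyT R c hR =>
    hm.trans (h δ hδ a ha S hS hsum hgood L w hLw x₀ K hKS hKq hmild hcool n xf hxf hrange L' w' U t hC lab hlab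
      (fun hin => hoff (bondTube_mono hsb hdI hdB hin)) y (bondTube_mono hsb₁ hdI₁ hdB₁ hyT) R c hR)

/-- ★ WEAKER-THAN CERTIFICATE: (DWᴸ) ⟹ (DWᴹ) (the minimality hypothesis is simply not used). [formal bookkeeping] -/
theorem DeficitWellP.toMin {ϑc ϑ ϑp r rΘ q rsh ρ rm σ ϑr Rs ε rI ℓ Rg sb₁ dI₁ dB₁ Rd cE σ₀ aHi Λ θ s : ℝ}
    (h : DeficitWellP ϑc ϑ ϑp r rΘ q rsh ρ rm σ ϑr Rs ε rI ℓ Rg sb₁ dI₁ dB₁ Rd cE σ₀ aHi Λ θ s) :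
    DeficitWellMinP ϑc ϑ ϑp r rΘ q rsh ρ rm σ ϑr Rs ε rI ℓ Rg sb₁ dI₁ dB₁ Rd cE σ₀ aHi Λ θ s :=
  fun δ hδ a ha S hS hsum hgood L w hLw x₀ K hKS hKq hmild hcool n xf hxf hrange L' w' U t hC lab hlab y hyT hyinj hydisj hcrit htame _ =>
    h δ hδ a ha S hS hsum hgood L w hLw x₀ K hKS hKq hmild hcool n xf hxf hrange L' w' U t hC lab hlab y hyT hyinj hydisj hcrit htame

/-- (DWᴹ) is antitone in the modulus, monotone in the slack, antitone in the pair range. [formal bookkeeping] -/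
theorem DeficitWellMinP.of_le {ϑc ϑ ϑp r rΘ q rsh ρ rm σ ϑr Rs ε rI ℓ Rg sb₁ dI₁ dB₁ Rd Rd' cE cE' σ₀ σ₀' aHi Λ θ s : ℝ} (hcE₀ : 0 ≤ cE')
    (hcE : cE' ≤ cE) (hσ : σ₀ ≤ σ₀') (hRd : Rd' ≤ Rd) (h : DeficitWellMinP ϑc ϑ ϑp r rΘ q rsh ρ rm σ ϑr Rs ε rI ℓ Rg sb₁ dI₁ dB₁ Rd cE σ₀ aHi Λ θ s) :
    DeficitWellMinP ϑc ϑ ϑp r rΘ q rsh ρ rm σ ϑr Rs ε rI ℓ Rg sb₁ dI₁ dB₁ Rd' cE' σ₀' aHi Λ θ s := by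
  intro δ hδ a ha S hS hsum hgood L w hLw x₀ K hKS hKq hmild hcool n xf hxf hrange L' w' U t hC lab hlab y hyT hyinj hydisj hcrit htame hmin
  obtain ⟨V, hV, hE⟩ :=
    h δ hδ a ha S hS hsum hgood L w hLw x₀ K hKS hKq hmild hcool n xf hxf hrange L' w' U t hC lab hlab y hyT hyinj hydisj hcrit htame hmin
  refine ⟨V, hV, ?_⟩
  have h1 : coreDeficit Rd' (fun i => lab (xf i)) y xf V ≤ coreDeficit Rd (fun i => lab (xf i)) y xf V := coreDeficit_mono hRd
  have h2 : 0 ≤ coreDeficit Rd' (fun i => lab (xf i)) y xf V := coreDeficit_nonneg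
  nlinarith [mul_le_mul_of_nonneg_left h1 hcE₀, mul_le_mul_of_nonneg_right hcE (h2.trans h1)]

end Pieces

end Summit.AtomisticToContinuum.Crystallization.Theorems.ChartedZeroExcessLayeredLatticeLiouville

end
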